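import Summits.QuantumFields.BalabanUV.T4Continuum.Spine.NE1p.DressedRebornMuPartSlotLettersTorus

/-!
# T⁴ programme, spine estimate NE1′ (node O3b/H2) — THE RE-BORN μ-PART AND ITS LINEAR RESPONSE AT THE ACTIVITY SLOT OF RECORD
# `(slotsOfRecord …).act`: S63 §2 ∕ S69 §2 (abstract geometry) and S70 §3 ∕ §4 (pv22's torus) read at `Op := OpDatum (SpeciesRec D o T ι′ Ω 𝒴)`,
# `A := L.A` with the activities written LITERALLY as `(slotsOfRecord D ι c a s P 𝒵 dom Jc V mI L).act p.1 p.2 op h` along the bi-pencil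
# `h₀ + μ • u + s • v` (`slotsOfRecord_act` is `rfl`) — S30 §3's ∕ S50-B's ∕ `…OnCoresSlotLettersTorus` §3's pattern VERBATIM for the
# DRESSED (bilinear) regeneration END and its response: the last standard level of the crew's matrix for this column

Cell `pub-balaban`, sub-cell `t4`, BINDER-OWNERS row NE1′; NE1′ formalisation crew, unit `b2b-balaban-t4-ne1p-formalise-leaf-03`
(LEAF PROVER 03, generation 15); crew row S⟨next⟩ of `t4/formal/NE1p/LEAVES.md` (own-lineage «slots of record» level of S63 ∕ S69 ∕ S70,
exactly as S30 §3 is S30 §2's and `DressedSmallFieldOnCoresSlotLettersTorus` §3 is its §2's).  ADDITIVE — imports S70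
`Spine/NE1p/DressedRebornMuPartSlotLettersTorus` ONLY (→ S63, S69 → S56 ∕ S61, S30-letters → the substrate's `SubstrateSlotsOfRecord`);
THEOREMS ONLY (4 thm, 0 def, 0 `def … : Prop`, 0 cite); nothing restated — each theorem is `rw [slotsOfRecord_act]; exact <parent> … L.A …`.

WHY THIS FILE.  Run B's dressed activities of record are `(slotsOfRecord …).act` (the substrate's `Slots` package, MAP §O1 O-8); by
`slotsOfRecord_act` (`rfl`) they ARE `actOfLetters … (coreLettersOf … L.A)` at `Op := OpDatum (SpeciesRec …)`.  Every other END of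
the crew has been read at this literal activity (S30 §3 attached ∕ μ-part; S50-B ∕ S60 analytic ENDs; their torus forms); the re-born
μ-part and its response had not (`grep -n slotsOfRecord Spine/NE1p/DressedRebornMu*.lean` = ∅).  Here:
* §1 `rebornMuPart_locE_le_slotsOfRecord_act` (S63 §2 ONCE) and §2 `rebornMuDeriv_locE_le_slotsOfRecord_act` (S69 §2 ONCE) — abstract
  `Geometry 𝔇 Cube`;
* §3 `rebornMuPart_locE_le_slotsOfRecord_act_torus` (S70 §3 ONCE) and §4 `rebornMuDeriv_locE_le_slotsOfRecord_act_torus` (S70 §4 ONCE) —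
  pv22's `tgeometry 4 N`, located numerals, conclusions pinned `locE (Dom := (tsys 4 N).Dom) (TTouch …) (fun Z => Z.1)`.
The class centre `ctr` stays GENERAL (its identification with run B's operator datum of record is the substrate's READING, NOT asserted).

WHAT STAYS DISPLAYED (binders, by name; NOTHING instantiated on Bałaban's densities): the slot letters `L : SlotLetters …` (their Gaussian
letters `L.A` enter S30 §1's blocks inside S63 ∕ S69), the substrate's primitive letter conditions `hbase` ∕ `hrdm` ∕ `hβ₀` ∕ `hd₀` ∕ `hrd` ∕
`hctr` ∕ `hbud` ∕ `hmq`; `hroom`; `hO` ∕ `hH` (room for BOTH directions); (B1b)'s residue `terms` ∕ `emb` ∕ `hscale`; the clause SHAPES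
(abstract: `hrate` ∕ `hsmall` with `b₅`; torus: `r₁ + 2·(64·log 162) + 2 ≤ R`, `A·e^{5r₁+1}·K₀(64,8)·9·64 ≤ 1`); (B3) = `hM3` (G-ne9p2-5,
UNPRINTED, shared with NE9, a BINDER); the source radius ∕ window, the content direction `v` with `0 < ‖v‖ < ε`.  `4M∕(μ₁ε)` and
`4M∕(ε(μ₁ − μ₀))` per unit content are READINGS of the dressed (w5) constant and its response — (B1a) discharged at the letters, (w5)∕(w6)
NOT discharged on Bałaban's densities.

HONEST FRAMING.  By-name junctions over SHAPES (`rfl`-level re-reading of four LANDED kernel theorems at the substrate's activity slot of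
record); (B1a) relocated onto row NE5's exp-linear FORMAT hypothesis — identification with Bałaban's (2.14) = the substrate's DISPLAYED
reading, NOT claimed; (B1b) ∕ (B3) ∕ (B5) NOT discharged; 0 binders instantiated on Bałaban's densities; no new inequality; no wall item of
NE1′ or NE5 moves; the NE1′ wall wording of record v1.8 (T4-DAG v48; v58 same words) — words, not kind — does NOT move; R-t4r2-Q2 NOT met;
ABSOLUTE RULE honoured ([folklore] kernel lemmas only; no numeral of print; no disputed step of the audited manuscripts enters as a fact).
NE1′ ⇐ the named binders — NOT proved, NOT printed; spine PROVED 0∕9; count 9 unchanged.  Rung (B)+1 on ONE finite four-torus — NOT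
infinite volume, NOT a mass gap, NOT OS on ℝ⁴, NOT Clay.  HONEST DEPENDENCY: continuum YM on T⁴ ⇐ BetaPertH ∧ nine spine estimates (0/9
proved); BetaPertH ⇐ (D1) ∧ (D4) ∧ CAP+tail; G-an2-4 gates asym, D1 and NE2/3/4.
-/

noncomputable section

namespace Summit.QuantumFields.BalabanUV.T4Continuum.NE1p.DressedRebornMuPartSlotsOfRecord

open scoped BigOperators Matrix
open Metric Set MeasureTheory
open Literature.MathematicalPhysics.QuantumFieldTheory.Balaban1983to89
open Literature.MathematicalPhysics.QuantumFieldTheory.Balaban1983to89.T4OutputRate (Carriers)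
open Literature.MathematicalPhysics.QuantumFieldTheory.Balaban1983to89.B13Resummation (locE Geometry)
open Literature.MathematicalPhysics.QuantumFieldTheory.Balaban1983to89.B5Prop11Lower (nsq)
open Literature.MathematicalPhysics.QuantumFieldTheory.Balaban1983to89.TreeLengthTorus (tsys torusTreeLen)
open Literature.MathematicalPhysics.QuantumFieldTheory.Balaban1983to89.TreeLengthTorusGeometry (TTouch tgeometry)
open Literature.MathematicalPhysics.QuantumFieldTheory.Balaban1983to89.B12TreeDecay (K₀)
open Summit.QuantumFields.BalabanUV.T4Continuum.B13OpDatum (OpDatum)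
open Summit.QuantumFields.BalabanUV.T4Continuum.B13HistMeasurable (MeasPotFrame B13HistM)
open Summit.QuantumFields.BalabanUV.T4Continuum.B13StepTermLabels (InnerLabel)
open Summit.QuantumFields.BalabanUV.T4Continuum.B13InnerData (Bnd)
open Summit.QuantumFields.BalabanUV.T4Continuum.SubstrateTwoRunsDriven (DrivenRuns)
open Summit.QuantumFields.BalabanUV.T4Continuum.SubstrateActivities (coreOf actOfLetters)
open Summit.QuantumFields.BalabanUV.T4Continuum.SubstrateGaussianLetters (gaussC linForm)
open Summit.QuantumFields.BalabanUV.T4Continuum.SubstrateGaussianLettersBall (detBudget)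
open Summit.QuantumFields.BalabanUV.T4Continuum.SubstrateSlotsOfRecord (ActLetters coreLettersOf SpeciesRec SlotLetters slotsOfRecord
  slotsOfRecord_act)
open Summit.QuantumFields.BalabanUV.T4Continuum.NE1p.DressedRebornMuPartSlotLetters (rebornMuPart_locE_le_of_coreLettersOf)
open Summit.QuantumFields.BalabanUV.T4Continuum.NE1p.DressedRebornMuResponseSlotLetters (rebornMuDeriv_locE_le_of_coreLettersOf)
open Summit.QuantumFields.BalabanUV.T4Continuum.NE1p.DressedRebornMuPartSlotLettersTorus (rebornMuPart_locE_le_of_coreLettersOf_torus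
  rebornMuDeriv_locE_le_of_coreLettersOf_torus)

variable {G : Type} [GaugeGroup G] (D : DrivenRuns G) (P : MeasPotFrame D.carriers)
variable {o : Type} [Fintype o] [DecidableEq o] (ι : G →* Matrix o o ℂ) (c : ℂ) (a : ℝ) (s : ℕ → ℂ)
variable {T ι' S Ω 𝒴 : Type} {IOp : Type*}
  (𝒵 : D.carriers.Dom → InnerLabel D.carriers.Dom (Bnd D.toTwoRuns) → Type) [∀ Z j, Fintype (𝒵 Z j)]
  (dom : ∀ Z j, 𝒵 Z j → D.carriers.Dom)
  (Jc : D.carriers.Dom → InnerLabel D.carriers.Dom (Bnd D.toTwoRuns) → Type) [∀ Z j, Fintype (Jc Z j)]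
  (V : D.carriers.Dom → InnerLabel D.carriers.Dom (Bnd D.toTwoRuns) → Type) [∀ Z j, NormedAddCommGroup (V Z j)]
  [∀ Z j, InnerProductSpace ℝ (V Z j)] [∀ Z j, MeasurableSpace (V Z j)] [∀ Z j, BorelSpace (V Z j)] [∀ Z j, FiniteDimensional ℝ (V Z j)]
  (mI : D.carriers.Dom → InnerLabel D.carriers.Dom (Bnd D.toTwoRuns) → Type) [∀ Z j, Fintype (mI Z j)] [∀ Z j, DecidableEq (mI Z j)]
  (L : SlotLetters D (o := o) (T := T) (ι' := ι') (S := S) (Ω := Ω) (𝒴 := 𝒴) P (IOp := IOp) 𝒵 dom Jc V mI)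

/-! ## §1–§2 AT THE ACTIVITY SLOT OF RECORD, ABSTRACT GEOMETRY -/

section Abstract
variable (𝔇 : LocDomainSys) {Cube : Type} [DecidableEq Cube] (Ge : Geometry 𝔇 Cube)

open Classical in
/-- **THE RE-BORN μ-PART OF THE DRESSED OUTPUT OF THE ACTIVITY SLOT OF RECORD** (kernel; S63 §2 `rebornMuPart_locE_le_of_coreLettersOf` at
`Op := OpDatum (SpeciesRec D o T ι′ Ω 𝒴)`, `A := L.A`, the activities written LITERALLY as `(slotsOfRecord D ι c a s P 𝒵 dom Jc V mI L).act
p.1 p.2 op h` along the bi-pencil `h₀ + μ • u + s • v` — `slotsOfRecord_act`, `rfl`; S30 §3's pattern).  The class centre `ctr` is GENERAL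
(its identification with run B's operator datum of record is the substrate's READING, NOT asserted). [folklore] -/
theorem rebornMuPart_locE_le_slotsOfRecord_act {W : Set (ℕ → ℝ)} {ctr : ℕ → (ℕ → ℝ) → D.carriers.BgB → (OpDatum (SpeciesRec D o T ι' Ω 𝒴)) × B13HistM P}
    {ROp RHist R' : ℕ → ℝ} {β₀ ϑ d₀ γ : D.carriers.Dom → InnerLabel D.carriers.Dom (Bnd D.toTwoRuns) → ℝ}
    (hroom : ∀ k, ROp k < R' k) (hR' : ∀ k, 0 ≤ R' k)
    (hbase : ∀ Z j ii jj, Measurable fun a' => (L.A Z j).base a' ii jj)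
    (hrdm : ∀ Z j ii jj (o' : (OpDatum (SpeciesRec D o T ι' Ω 𝒴))), Measurable fun a' => (L.A Z j).rd a' ii jj o')
    (hβ₀ : ∀ Z j, 0 ≤ β₀ Z j) (hd₀ : ∀ Z j, 0 < d₀ Z j)
    (hrd : ∀ Z j a' ii jj, ‖(L.A Z j).rd a' ii jj‖ ≤ ϑ Z j)
    (hctr : ∀ k, ∀ g ∈ W, ∀ (U : D.carriers.BgB) (Z : D.carriers.Dom) (j : InnerLabel D.carriers.Dom (Bnd D.toTwoRuns))
      (a' : (Jc Z j ⊕ 𝒵 Z j) → ℝ × ℝ),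
      (∀ ii jj, ‖linForm (L.A Z j).base (L.A Z j).rd (ctr k g U).1 a' ii jj‖ ≤ β₀ Z j) ∧
      ((linForm (L.A Z j).base (L.A Z j).rd (ctr k g U).1 a').det).im = 0 ∧ d₀ Z j ≤ ((linForm (L.A Z j).base (L.A Z j).rd (ctr k g U).1 a').det).re ∧
      (∀ x : mI Z j → ℂ, γ Z j * nsq x ≤ (star x ⬝ᵥ (linForm (L.A Z j).base (L.A Z j).rd (ctr k g U).1 a' *ᵥ x)).re))
    (hbud : ∀ k Z j, detBudget (Fintype.card (mI Z j)) (β₀ Z j) (ϑ Z j) (R' k) < d₀ Z j)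
    (hmq : ∀ k Z j, Fintype.card (mI Z j) * ϑ Z j * R' k < γ Z j)
    {k : ℕ} {g : ℕ → ℝ} (hg : g ∈ W) {U : D.carriers.BgB} {op : (OpDatum (SpeciesRec D o T ι' Ω 𝒴))} {h₀ u v : B13HistM P} {μ₁ ε : ℝ}
    (hv : 0 < ‖v‖) (hvε : ‖v‖ < ε)
    (hO : ‖op - (ctr k g U).1‖ ≤ ROp k) (hH : ‖h₀ - (ctr k g U).2‖ + μ₁ * ‖u‖ + ε ≤ RHist k)
    {emb : 𝔇.Dom → D.carriers.Dom} (hscale : ∀ Z, D.carriers.scale (emb Z) = k)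
    (terms : 𝔇.Dom → Finset (D.carriers.Dom × InnerLabel D.carriers.Dom (Bnd D.toTwoRuns)))
    {A' R r₁ b₅ : ℝ} {X₀ : 𝔇.Dom} (hA : 0 ≤ A') (hr₁ : 0 ≤ r₁) (hb : r₁ * 5 ≤ b₅)
    (hrate : r₁ + 2 * Ge.κ₀ + 2 ≤ R) (hsmall : A' * Real.exp (b₅ + 1) * Ge.K₀ * Ge.ν * Ge.c₁ ≤ 1)
    (hM3 : ∀ Z, Ge.cubes Z ⊆ Ge.cubes X₀ →
      ∑ p ∈ terms Z, (coreOf P (OpDatum (SpeciesRec D o T ι' Ω 𝒴)) 𝒵 dom Jc V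
            (coreLettersOf D P (OpDatum (SpeciesRec D o T ι' Ω 𝒴)) 𝒵 dom Jc V mI L.A) p.1 p.2).lam.real univ *
          ((coreOf P (OpDatum (SpeciesRec D o T ι' Ω 𝒴)) 𝒵 dom Jc V
            (coreLettersOf D P (OpDatum (SpeciesRec D o T ι' Ω 𝒴)) 𝒵 dom Jc V mI L.A) p.1 p.2).wB *
              (gaussC (mI p.1 p.2) * Real.sqrt (max 1 ((Fintype.card (mI p.1 p.2)).factorial *
                β₀ p.1 p.2 ^ Fintype.card (mI p.1 p.2) + d₀ p.1 p.2))) * Real.exp 0) *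
          (Real.pi / ((γ p.1 p.2 - Fintype.card (mI p.1 p.2) * ϑ p.1 p.2 * R' k) / 2 / 2)) ^ (Module.finrank ℝ (V p.1 p.2) / 2 : ℝ) *
        Real.exp ((coreOf P (OpDatum (SpeciesRec D o T ι' Ω 𝒴)) 𝒵 dom Jc V
            (coreLettersOf D P (OpDatum (SpeciesRec D o T ι' Ω 𝒴)) 𝒵 dom Jc V mI L.A) p.1 p.2).N₁ * (‖h₀‖ + μ₁ * ‖u‖ + ε)) ≤
        A' * Real.exp (-(R * 𝔇.dj Z)))
    {μ : ℂ} (hμ : μ ∈ ball (0 : ℂ) μ₁) :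
    ‖locE Ge.ι Ge.cubes (fun Z => ∑ p ∈ terms Z,
          (slotsOfRecord D ι c a s P 𝒵 dom Jc V mI L).act p.1 p.2 op (h₀ + μ • u + (1 : ℂ) • v)) (Ge.cubes X₀) -
        locE Ge.ι Ge.cubes (fun Z => ∑ p ∈ terms Z,
          (slotsOfRecord D ι c a s P 𝒵 dom Jc V mI L).act p.1 p.2 op (h₀ + (0 : ℂ) • u + (1 : ℂ) • v))
          (Ge.cubes X₀) -
        (locE Ge.ι Ge.cubes (fun Z => ∑ p ∈ terms Z,
            (slotsOfRecord D ι c a s P 𝒵 dom Jc V mI L).act p.1 p.2 op (h₀ + μ • u + (0 : ℂ) • v))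
            (Ge.cubes X₀) -
          locE Ge.ι Ge.cubes (fun Z => ∑ p ∈ terms Z,
            (slotsOfRecord D ι c a s P 𝒵 dom Jc V mI L).act p.1 p.2 op (h₀ + (0 : ℂ) • u + (0 : ℂ) • v))
            (Ge.cubes X₀))‖ ≤
      2 * (2 * (Real.exp 1 * Ge.ν * Ge.c₁ * Ge.K₀ ^ 2 * A' * Real.exp (-(r₁ * 𝔇.dj X₀))) / μ₁ * ‖μ‖) / ε * ‖v‖ := by
  rw [slotsOfRecord_act]
  exact rebornMuPart_locE_le_of_coreLettersOf D P (OpDatum (SpeciesRec D o T ι' Ω 𝒴)) 𝒵 dom Jc V mI 𝔇 Ge L.A hroom hR' hbase hrdm hβ₀ hd₀ hrd hctr hbud hmq hg hv hvε hO hH hscale terms hA hr₁ hb hrate hsmall hM3 hμ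

open Classical in
/-- **THE RESPONSE OF THE RE-BORN PART OF THE DRESSED OUTPUT OF THE ACTIVITY SLOT OF RECORD** (kernel; S69 §2
`rebornMuDeriv_locE_le_of_coreLettersOf` at `Op := OpDatum (SpeciesRec …)`, `A := L.A`, activities LITERALLY `(slotsOfRecord …).act`; the
window `‖μ‖ ≤ μ₀ < μ₁`). [folklore] -/
theorem rebornMuDeriv_locE_le_slotsOfRecord_act {W : Set (ℕ → ℝ)} {ctr : ℕ → (ℕ → ℝ) → D.carriers.BgB → (OpDatum (SpeciesRec D o T ι' Ω 𝒴)) × B13HistM P}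
    {ROp RHist R' : ℕ → ℝ} {β₀ ϑ d₀ γ : D.carriers.Dom → InnerLabel D.carriers.Dom (Bnd D.toTwoRuns) → ℝ}
    (hroom : ∀ k, ROp k < R' k) (hR' : ∀ k, 0 ≤ R' k)
    (hbase : ∀ Z j ii jj, Measurable fun a' => (L.A Z j).base a' ii jj)
    (hrdm : ∀ Z j ii jj (o' : (OpDatum (SpeciesRec D o T ι' Ω 𝒴))), Measurable fun a' => (L.A Z j).rd a' ii jj o')
    (hβ₀ : ∀ Z j, 0 ≤ β₀ Z j) (hd₀ : ∀ Z j, 0 < d₀ Z j)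
    (hrd : ∀ Z j a' ii jj, ‖(L.A Z j).rd a' ii jj‖ ≤ ϑ Z j)
    (hctr : ∀ k, ∀ g ∈ W, ∀ (U : D.carriers.BgB) (Z : D.carriers.Dom) (j : InnerLabel D.carriers.Dom (Bnd D.toTwoRuns))
      (a' : (Jc Z j ⊕ 𝒵 Z j) → ℝ × ℝ),
      (∀ ii jj, ‖linForm (L.A Z j).base (L.A Z j).rd (ctr k g U).1 a' ii jj‖ ≤ β₀ Z j) ∧
      ((linForm (L.A Z j).base (L.A Z j).rd (ctr k g U).1 a').det).im = 0 ∧ d₀ Z j ≤ ((linForm (L.A Z j).base (L.A Z j).rd (ctr k g U).1 a').det).re ∧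
      (∀ x : mI Z j → ℂ, γ Z j * nsq x ≤ (star x ⬝ᵥ (linForm (L.A Z j).base (L.A Z j).rd (ctr k g U).1 a' *ᵥ x)).re))
    (hbud : ∀ k Z j, detBudget (Fintype.card (mI Z j)) (β₀ Z j) (ϑ Z j) (R' k) < d₀ Z j)
    (hmq : ∀ k Z j, Fintype.card (mI Z j) * ϑ Z j * R' k < γ Z j)
    {k : ℕ} {g : ℕ → ℝ} (hg : g ∈ W) {U : D.carriers.BgB} {op : (OpDatum (SpeciesRec D o T ι' Ω 𝒴))} {h₀ u v : B13HistM P} {μ₁ ε : ℝ}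
    (hv : 0 < ‖v‖) (hvε : ‖v‖ < ε)
    (hO : ‖op - (ctr k g U).1‖ ≤ ROp k) (hH : ‖h₀ - (ctr k g U).2‖ + μ₁ * ‖u‖ + ε ≤ RHist k)
    {emb : 𝔇.Dom → D.carriers.Dom} (hscale : ∀ Z, D.carriers.scale (emb Z) = k)
    (terms : 𝔇.Dom → Finset (D.carriers.Dom × InnerLabel D.carriers.Dom (Bnd D.toTwoRuns)))
    {A' R r₁ b₅ : ℝ} {X₀ : 𝔇.Dom} (hA : 0 ≤ A') (hr₁ : 0 ≤ r₁) (hb : r₁ * 5 ≤ b₅)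
    (hrate : r₁ + 2 * Ge.κ₀ + 2 ≤ R) (hsmall : A' * Real.exp (b₅ + 1) * Ge.K₀ * Ge.ν * Ge.c₁ ≤ 1)
    (hM3 : ∀ Z, Ge.cubes Z ⊆ Ge.cubes X₀ →
      ∑ p ∈ terms Z, (coreOf P (OpDatum (SpeciesRec D o T ι' Ω 𝒴)) 𝒵 dom Jc V
            (coreLettersOf D P (OpDatum (SpeciesRec D o T ι' Ω 𝒴)) 𝒵 dom Jc V mI L.A) p.1 p.2).lam.real univ *
          ((coreOf P (OpDatum (SpeciesRec D o T ι' Ω 𝒴)) 𝒵 dom Jc V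
            (coreLettersOf D P (OpDatum (SpeciesRec D o T ι' Ω 𝒴)) 𝒵 dom Jc V mI L.A) p.1 p.2).wB *
              (gaussC (mI p.1 p.2) * Real.sqrt (max 1 ((Fintype.card (mI p.1 p.2)).factorial *
                β₀ p.1 p.2 ^ Fintype.card (mI p.1 p.2) + d₀ p.1 p.2))) * Real.exp 0) *
          (Real.pi / ((γ p.1 p.2 - Fintype.card (mI p.1 p.2) * ϑ p.1 p.2 * R' k) / 2 / 2)) ^ (Module.finrank ℝ (V p.1 p.2) / 2 : ℝ) *
        Real.exp ((coreOf P (OpDatum (SpeciesRec D o T ι' Ω 𝒴)) 𝒵 dom Jc V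
            (coreLettersOf D P (OpDatum (SpeciesRec D o T ι' Ω 𝒴)) 𝒵 dom Jc V mI L.A) p.1 p.2).N₁ * (‖h₀‖ + μ₁ * ‖u‖ + ε)) ≤
        A' * Real.exp (-(R * 𝔇.dj Z)))
    {μ₀ : ℝ} (h01 : μ₀ < μ₁) {μ : ℂ} (hμ : ‖μ‖ ≤ μ₀) :
    ‖deriv (fun m : ℂ =>
        locE Ge.ι Ge.cubes (fun Z => ∑ p ∈ terms Z,
            (slotsOfRecord D ι c a s P 𝒵 dom Jc V mI L).act p.1 p.2 op (h₀ + m • u + (1 : ℂ) • v))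
            (Ge.cubes X₀) -
          locE Ge.ι Ge.cubes (fun Z => ∑ p ∈ terms Z,
            (slotsOfRecord D ι c a s P 𝒵 dom Jc V mI L).act p.1 p.2 op (h₀ + m • u + (0 : ℂ) • v))
            (Ge.cubes X₀)) μ‖ ≤
      2 * (2 * (Real.exp 1 * Ge.ν * Ge.c₁ * Ge.K₀ ^ 2 * A' * Real.exp (-(r₁ * 𝔇.dj X₀))) / ε * ‖v‖) / (μ₁ - μ₀) := by
  rw [slotsOfRecord_act]
  exact rebornMuDeriv_locE_le_of_coreLettersOf D P (OpDatum (SpeciesRec D o T ι' Ω 𝒴)) 𝒵 dom Jc V mI 𝔇 Ge L.A hroom hR' hbase hrdm hβ₀ hd₀ hrd hctr hbud hmq hg hv hvε hO hH hscale terms hA hr₁ hb hrate hsmall hM3 h01 hμ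

end Abstract

/-! ## §3–§4 AT THE ACTIVITY SLOT OF RECORD, ON THE TORUS (pv22's `tgeometry 4 N`, located numerals) -/

section Torus
variable {N : ℕ} [NeZero N]

open Classical in
/-- **THE RE-BORN μ-PART OF THE ACTIVITY SLOT OF RECORD, ON THE TORUS** (kernel; S70 §3 `rebornMuPart_locE_le_of_coreLettersOf_torus` at
`Op := OpDatum (SpeciesRec …)`, `A := L.A`, activities LITERALLY `(slotsOfRecord …).act`; NO geometry hypothesis). [folklore] -/
theorem rebornMuPart_locE_le_slotsOfRecord_act_torus {W : Set (ℕ → ℝ)} {ctr : ℕ → (ℕ → ℝ) → D.carriers.BgB → (OpDatum (SpeciesRec D o T ι' Ω 𝒴)) × B13HistM P}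
    {ROp RHist R' : ℕ → ℝ} {β₀ ϑ d₀ γ : D.carriers.Dom → InnerLabel D.carriers.Dom (Bnd D.toTwoRuns) → ℝ}
    (hroom : ∀ k, ROp k < R' k) (hR' : ∀ k, 0 ≤ R' k)
    (hbase : ∀ Z j ii jj, Measurable fun a' => (L.A Z j).base a' ii jj)
    (hrdm : ∀ Z j ii jj (o' : (OpDatum (SpeciesRec D o T ι' Ω 𝒴))), Measurable fun a' => (L.A Z j).rd a' ii jj o')
    (hβ₀ : ∀ Z j, 0 ≤ β₀ Z j) (hd₀ : ∀ Z j, 0 < d₀ Z j)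
    (hrd : ∀ Z j a' ii jj, ‖(L.A Z j).rd a' ii jj‖ ≤ ϑ Z j)
    (hctr : ∀ k, ∀ g ∈ W, ∀ (U : D.carriers.BgB) (Z : D.carriers.Dom) (j : InnerLabel D.carriers.Dom (Bnd D.toTwoRuns))
      (a' : (Jc Z j ⊕ 𝒵 Z j) → ℝ × ℝ),
      (∀ ii jj, ‖linForm (L.A Z j).base (L.A Z j).rd (ctr k g U).1 a' ii jj‖ ≤ β₀ Z j) ∧
      ((linForm (L.A Z j).base (L.A Z j).rd (ctr k g U).1 a').det).im = 0 ∧ d₀ Z j ≤ ((linForm (L.A Z j).base (L.A Z j).rd (ctr k g U).1 a').det).re ∧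
      (∀ x : mI Z j → ℂ, γ Z j * nsq x ≤ (star x ⬝ᵥ (linForm (L.A Z j).base (L.A Z j).rd (ctr k g U).1 a' *ᵥ x)).re))
    (hbud : ∀ k Z j, detBudget (Fintype.card (mI Z j)) (β₀ Z j) (ϑ Z j) (R' k) < d₀ Z j)
    (hmq : ∀ k Z j, Fintype.card (mI Z j) * ϑ Z j * R' k < γ Z j)
    {k : ℕ} {g : ℕ → ℝ} (hg : g ∈ W) {U : D.carriers.BgB} {op : (OpDatum (SpeciesRec D o T ι' Ω 𝒴))} {h₀ u v : B13HistM P} {μ₁ ε : ℝ}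
    (hv : 0 < ‖v‖) (hvε : ‖v‖ < ε)
    (hO : ‖op - (ctr k g U).1‖ ≤ ROp k) (hH : ‖h₀ - (ctr k g U).2‖ + μ₁ * ‖u‖ + ε ≤ RHist k)
    {emb : (tsys 4 N).Dom → D.carriers.Dom} (hscale : ∀ Z, D.carriers.scale (emb Z) = k)
    (terms : (tsys 4 N).Dom → Finset (D.carriers.Dom × InnerLabel D.carriers.Dom (Bnd D.toTwoRuns)))
    {A' R r₁ : ℝ} (X₀ : (tsys 4 N).Dom) (hA : 0 ≤ A') (hr₁ : 0 ≤ r₁)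
    (hrate : r₁ + 2 * (64 * Real.log 162) + 2 ≤ R) (hsmall : A' * Real.exp (5 * r₁ + 1) * K₀ 64 8 * 9 * 64 ≤ 1)
    (hM3 : ∀ Z : (tsys 4 N).Dom, Z.1 ⊆ X₀.1 →
      ∑ p ∈ terms Z, (coreOf P (OpDatum (SpeciesRec D o T ι' Ω 𝒴)) 𝒵 dom Jc V
            (coreLettersOf D P (OpDatum (SpeciesRec D o T ι' Ω 𝒴)) 𝒵 dom Jc V mI L.A) p.1 p.2).lam.real univ *
          ((coreOf P (OpDatum (SpeciesRec D o T ι' Ω 𝒴)) 𝒵 dom Jc V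
            (coreLettersOf D P (OpDatum (SpeciesRec D o T ι' Ω 𝒴)) 𝒵 dom Jc V mI L.A) p.1 p.2).wB *
              (gaussC (mI p.1 p.2) * Real.sqrt (max 1 ((Fintype.card (mI p.1 p.2)).factorial *
                β₀ p.1 p.2 ^ Fintype.card (mI p.1 p.2) + d₀ p.1 p.2))) * Real.exp 0) *
          (Real.pi / ((γ p.1 p.2 - Fintype.card (mI p.1 p.2) * ϑ p.1 p.2 * R' k) / 2 / 2)) ^ (Module.finrank ℝ (V p.1 p.2) / 2 : ℝ) *
        Real.exp ((coreOf P (OpDatum (SpeciesRec D o T ι' Ω 𝒴)) 𝒵 dom Jc V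
            (coreLettersOf D P (OpDatum (SpeciesRec D o T ι' Ω 𝒴)) 𝒵 dom Jc V mI L.A) p.1 p.2).N₁ * (‖h₀‖ + μ₁ * ‖u‖ + ε)) ≤
        A' * Real.exp (-(R * torusTreeLen Z.1)))
    {μ : ℂ} (hμ : μ ∈ ball (0 : ℂ) μ₁) :
    ‖locE (Dom := (tsys 4 N).Dom) (TTouch (d := 4) (N := N)) (fun Z : (tsys 4 N).Dom => Z.1) (fun Z => ∑ p ∈ terms Z,
          (slotsOfRecord D ι c a s P 𝒵 dom Jc V mI L).act p.1 p.2 op (h₀ + μ • u + (1 : ℂ) • v)) X₀.1 -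
        locE (Dom := (tsys 4 N).Dom) (TTouch (d := 4) (N := N)) (fun Z : (tsys 4 N).Dom => Z.1) (fun Z => ∑ p ∈ terms Z,
          (slotsOfRecord D ι c a s P 𝒵 dom Jc V mI L).act p.1 p.2 op (h₀ + (0 : ℂ) • u + (1 : ℂ) • v))
          X₀.1 -
        (locE (Dom := (tsys 4 N).Dom) (TTouch (d := 4) (N := N)) (fun Z : (tsys 4 N).Dom => Z.1) (fun Z => ∑ p ∈ terms Z,
            (slotsOfRecord D ι c a s P 𝒵 dom Jc V mI L).act p.1 p.2 op (h₀ + μ • u + (0 : ℂ) • v))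
            X₀.1 -
          locE (Dom := (tsys 4 N).Dom) (TTouch (d := 4) (N := N)) (fun Z : (tsys 4 N).Dom => Z.1) (fun Z => ∑ p ∈ terms Z,
            (slotsOfRecord D ι c a s P 𝒵 dom Jc V mI L).act p.1 p.2 op (h₀ + (0 : ℂ) • u + (0 : ℂ) • v))
            X₀.1)‖ ≤
      2 * (2 * (Real.exp 1 * 9 * 64 * K₀ 64 8 ^ 2 * A' * Real.exp (-(r₁ * torusTreeLen X₀.1))) / μ₁ * ‖μ‖) / ε * ‖v‖ := by
  rw [slotsOfRecord_act]
  exact rebornMuPart_locE_le_of_coreLettersOf_torus D P (OpDatum (SpeciesRec D o T ι' Ω 𝒴)) 𝒵 dom Jc V mI L.A hroom hR' hbase hrdm hβ₀ hd₀ hrd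
    hctr hbud hmq hg hv hvε hO hH hscale terms X₀ hA hr₁ hrate hsmall hM3 hμ

open Classical in
/-- **THE RESPONSE OF THE RE-BORN PART OF THE ACTIVITY SLOT OF RECORD, ON THE TORUS** (kernel; S70 §4
`rebornMuDeriv_locE_le_of_coreLettersOf_torus` at `Op := OpDatum (SpeciesRec …)`, `A := L.A`; window `‖μ‖ ≤ μ₀ < μ₁`). [folklore] -/
theorem rebornMuDeriv_locE_le_slotsOfRecord_act_torus {W : Set (ℕ → ℝ)} {ctr : ℕ → (ℕ → ℝ) → D.carriers.BgB → (OpDatum (SpeciesRec D o T ι' Ω 𝒴)) × B13HistM P}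
    {ROp RHist R' : ℕ → ℝ} {β₀ ϑ d₀ γ : D.carriers.Dom → InnerLabel D.carriers.Dom (Bnd D.toTwoRuns) → ℝ}
    (hroom : ∀ k, ROp k < R' k) (hR' : ∀ k, 0 ≤ R' k)
    (hbase : ∀ Z j ii jj, Measurable fun a' => (L.A Z j).base a' ii jj)
    (hrdm : ∀ Z j ii jj (o' : (OpDatum (SpeciesRec D o T ι' Ω 𝒴))), Measurable fun a' => (L.A Z j).rd a' ii jj o')
    (hβ₀ : ∀ Z j, 0 ≤ β₀ Z j) (hd₀ : ∀ Z j, 0 < d₀ Z j)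
    (hrd : ∀ Z j a' ii jj, ‖(L.A Z j).rd a' ii jj‖ ≤ ϑ Z j)
    (hctr : ∀ k, ∀ g ∈ W, ∀ (U : D.carriers.BgB) (Z : D.carriers.Dom) (j : InnerLabel D.carriers.Dom (Bnd D.toTwoRuns))
      (a' : (Jc Z j ⊕ 𝒵 Z j) → ℝ × ℝ),
      (∀ ii jj, ‖linForm (L.A Z j).base (L.A Z j).rd (ctr k g U).1 a' ii jj‖ ≤ β₀ Z j) ∧
      ((linForm (L.A Z j).base (L.A Z j).rd (ctr k g U).1 a').det).im = 0 ∧ d₀ Z j ≤ ((linForm (L.A Z j).base (L.A Z j).rd (ctr k g U).1 a').det).re ∧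
      (∀ x : mI Z j → ℂ, γ Z j * nsq x ≤ (star x ⬝ᵥ (linForm (L.A Z j).base (L.A Z j).rd (ctr k g U).1 a' *ᵥ x)).re))
    (hbud : ∀ k Z j, detBudget (Fintype.card (mI Z j)) (β₀ Z j) (ϑ Z j) (R' k) < d₀ Z j)
    (hmq : ∀ k Z j, Fintype.card (mI Z j) * ϑ Z j * R' k < γ Z j)
    {k : ℕ} {g : ℕ → ℝ} (hg : g ∈ W) {U : D.carriers.BgB} {op : (OpDatum (SpeciesRec D o T ι' Ω 𝒴))} {h₀ u v : B13HistM P} {μ₁ ε : ℝ}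
    (hv : 0 < ‖v‖) (hvε : ‖v‖ < ε)
    (hO : ‖op - (ctr k g U).1‖ ≤ ROp k) (hH : ‖h₀ - (ctr k g U).2‖ + μ₁ * ‖u‖ + ε ≤ RHist k)
    {emb : (tsys 4 N).Dom → D.carriers.Dom} (hscale : ∀ Z, D.carriers.scale (emb Z) = k)
    (terms : (tsys 4 N).Dom → Finset (D.carriers.Dom × InnerLabel D.carriers.Dom (Bnd D.toTwoRuns)))
    {A' R r₁ : ℝ} (X₀ : (tsys 4 N).Dom) (hA : 0 ≤ A') (hr₁ : 0 ≤ r₁)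
    (hrate : r₁ + 2 * (64 * Real.log 162) + 2 ≤ R) (hsmall : A' * Real.exp (5 * r₁ + 1) * K₀ 64 8 * 9 * 64 ≤ 1)
    (hM3 : ∀ Z : (tsys 4 N).Dom, Z.1 ⊆ X₀.1 →
      ∑ p ∈ terms Z, (coreOf P (OpDatum (SpeciesRec D o T ι' Ω 𝒴)) 𝒵 dom Jc V
            (coreLettersOf D P (OpDatum (SpeciesRec D o T ι' Ω 𝒴)) 𝒵 dom Jc V mI L.A) p.1 p.2).lam.real univ *
          ((coreOf P (OpDatum (SpeciesRec D o T ι' Ω 𝒴)) 𝒵 dom Jc V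
            (coreLettersOf D P (OpDatum (SpeciesRec D o T ι' Ω 𝒴)) 𝒵 dom Jc V mI L.A) p.1 p.2).wB *
              (gaussC (mI p.1 p.2) * Real.sqrt (max 1 ((Fintype.card (mI p.1 p.2)).factorial *
                β₀ p.1 p.2 ^ Fintype.card (mI p.1 p.2) + d₀ p.1 p.2))) * Real.exp 0) *
          (Real.pi / ((γ p.1 p.2 - Fintype.card (mI p.1 p.2) * ϑ p.1 p.2 * R' k) / 2 / 2)) ^ (Module.finrank ℝ (V p.1 p.2) / 2 : ℝ) *
        Real.exp ((coreOf P (OpDatum (SpeciesRec D o T ι' Ω 𝒴)) 𝒵 dom Jc V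
            (coreLettersOf D P (OpDatum (SpeciesRec D o T ι' Ω 𝒴)) 𝒵 dom Jc V mI L.A) p.1 p.2).N₁ * (‖h₀‖ + μ₁ * ‖u‖ + ε)) ≤
        A' * Real.exp (-(R * torusTreeLen Z.1)))
    {μ₀ : ℝ} (h01 : μ₀ < μ₁) {μ : ℂ} (hμ : ‖μ‖ ≤ μ₀) :
    ‖deriv (fun m : ℂ =>
        locE (Dom := (tsys 4 N).Dom) (TTouch (d := 4) (N := N)) (fun Z : (tsys 4 N).Dom => Z.1) (fun Z => ∑ p ∈ terms Z,
            (slotsOfRecord D ι c a s P 𝒵 dom Jc V mI L).act p.1 p.2 op (h₀ + m • u + (1 : ℂ) • v))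
            X₀.1 -
          locE (Dom := (tsys 4 N).Dom) (TTouch (d := 4) (N := N)) (fun Z : (tsys 4 N).Dom => Z.1) (fun Z => ∑ p ∈ terms Z,
            (slotsOfRecord D ι c a s P 𝒵 dom Jc V mI L).act p.1 p.2 op (h₀ + m • u + (0 : ℂ) • v))
            X₀.1) μ‖ ≤
      2 * (2 * (Real.exp 1 * 9 * 64 * K₀ 64 8 ^ 2 * A' * Real.exp (-(r₁ * torusTreeLen X₀.1))) / ε * ‖v‖) / (μ₁ - μ₀) := by
  rw [slotsOfRecord_act]
  exact rebornMuDeriv_locE_le_of_coreLettersOf_torus D P (OpDatum (SpeciesRec D o T ι' Ω 𝒴)) 𝒵 dom Jc V mI L.A hroom hR' hbase hrdm hβ₀ hd₀ hrd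
    hctr hbud hmq hg hv hvε hO hH hscale terms X₀ hA hr₁ hrate hsmall hM3 h01 hμ

end Torus

end Summit.QuantumFields.BalabanUV.T4Continuum.NE1p.DressedRebornMuPartSlotsOfRecord

end
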